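import Mathlib.Tactic.Linarith
import Mathlib.Tactic.Ring
import Mathlib.Tactic.NormNum
import Mathlib.Tactic.FieldSimp
import Mathlib.Tactic.LinearCombination
import Mathlib.Algebra.GroupWithZero.Basic
import HarnessLib

/-!
# The (0,1) cell of the ι-window, EXISTENCE side, XIII: [XI] 3.6 (a) is a theorem — the scalar (⋆) is the
# degree-two component of the lift equation, and THEOREM W for the δ = 2 rows by bending the subbundle —
# arithmetic / algebra skeleton of `H2-EXISTENCE-SIDE-13.md`

Family `hodge`, b2b cell `hweil`, `Summits/HodgeConjecture/HodgeConjecture/Theorems` (helper of item stmt-HodgeConjecture-2524, the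
Weil-sixfold rung the H2 test serves). Companion to `WeilTypeLadderH2W2CornerEight … Twelve.lean` ([VIII]–[XII]) with the SAME dictionary:
`X = J(C)`, `C` general of genus `4` on the smooth quadric `Q = {q = 0}`, `q = x₀₀x₁₁ − x₀₁x₁₀` on `T₀J = k⁴` (rulings `g`, `h`), `ι = −1`,
`Θ_n = W₃ − h`, `Θ_{−n} = W₃ − g` (local equations `θ₊ = q + c₃ + …`, `θ₋ = ι^*θ₊`), `S = Θ_n ∩ Θ_{−n} = C − C`, the `j = 2` saturated corner sheaf
`F̂ = F̂_{z₁}` (vertex module `Rf_u + Rf_v`, `f_u = (û, ι^*û)` even of order `1` with `lin û = u₁ = ⟨ℓ^h_p, z₁⟩`, `f_v = (v̂, −ι^*v̂)` odd of order `2`),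
the rank-`2` bundle `𝓥₁ = (F̂ ⊗ 𝒪_{Z₁})/tors` on `Z₁ = z₁ − C` (free at the vertex on `e_u, e_v`), its degree-`2` sub-line-bundles `K₀ = A(−2P)`
(`K₀(0) = V₋`) and `K_{σ₊}` (`K(0) = V₊`), the (R0) candidates `F_K = ker(F̂ ↠ T^Y_K)` on the tacnodal curve `Y = Z₁ ∪ Z₂`, the rigid Kummer move
`β = ζ = Ċ(z₁)`, `w = −2ζ ∈ Π″ = cone(ℓ^h_{z₁})`, `σ = t_w ∘ ι`, centre `0^ε = εw/2` (the point `τ = ε` of `Z₁[ε]`), THEOREM L's deformation `F̂^ε`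
([XII] 4.1, certified referee-g97 R579), the LIFT EQUATION `a′v̂ − ûb′ − r₁θ₊ − r₁′θ₋ = v̂∂_w a − û∂_w b_v − r₀′∂_wθ₋` ([XI] 3.4) with `lin b′ = −λu₁`,
and the linear forms `m = v̂₂(ζ, ·)`, `q_ζ = q(ζ, ·)`, `ρ₁ = lin r₀`. Report `run/shared/lean/b2b/hodge-weil/b2b-hweil-pv3-g20/H2-EXISTENCE-SIDE-13.md`
(THEOREM A: (⋆) holds; THEOREM B: THEOREM W for the δ = 2 rows by bending `K`), CLAIM TABLE v58 (LADDER C366) row pv3-g20 + referee-g97 R580 ORDER (1)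
(W-P3g18-W-a second half); code `run/shared/lean/b2b/hodge-weil/code/pv3-g20/`. Def-free, fully proved ELEMENTARY statements (coefficient and
dual-number bookkeeping, a zero-divisor step, integer congruences); the sheaf theory is in the docstrings and the report. HONEST FRAMING: structure
results about one cell of the ladder's H2 test on the existence side, on the Jacobian locus only; no case of the Hodge conjecture is proved; nothing
here is a rung; no statement of [Markman 2025] is used; nothing here depends on (LP), (8.3.3) or on 'ker ob = ann(ch)'.

§1 the centre fibre (`centre_fibre_involution`, `dual_number_ideal_identities`); §2 THEOREM A (`degree_two_bookkeeping`, `restriction_to_Pi2`);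
§3 THEOREM B (`bending_bookkeeping`); §4 the table and the `σ₊` reduction (`R0_table_final`, `sigma_plus_reduction_degree`); §5 the machine cross-check
(`machine_crosscheck_lambda_mu`).

What is NOT here: sheaves, `ψ^ε`, `𝓥₁`, the families, the Ext groups. 0 unconditional rungs above the floor.
-/

set_option linter.dupNamespace false

namespace Summit.HodgeConjecture.HodgeConjecture.WeilTypeLadder

section H2W2CornerThirteen

/-- LEMMA 1.4 (report): the involution of the centre fibre. `A₁ : F̂^ε(0^ε) ⥲ 𝓥₁[ε](0^ε)` transports `σ` to an involution `Φ` of the free rank-`2`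
`k[ε]`-module `𝓥₁[ε](0^ε)`; in the constant basis `(e_u, e_v)` it is `Φ = (1, εa; εb, −1)` with `a =` the `e_u`-coefficient of `[ι^*b′](P)` and
`b =` the `e_v`-coefficient of `[ι^*a′](P)` (from `A₁(f_u^{ε,+}) = e_u + (ε/2)[ι^*a′]`, `A₁(f_v^{ε,−}) = e_v − (ε/2)[ι^*b′]`). Any such matrix is an
involution over `k[ε]` (the four entries of `Φ²` below, read modulo `ε² = 0`, are `1, 0, 0, 1`), and the `Φ`-stable `k[ε]`-lines through `V₋`, `V₊` are
UNIQUE: `Φ(e_v + εc·e_u) = −(e_v + εc·e_u) + ε(a + 2c)e_u` is a multiple iff `a + 2c = 0` iff `c = −a/2` (the line `L₋`), and `Φ(e_u + εc·e_v) =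
(e_u + εc·e_v) + ε(b − 2c)e_v` iff `c = b/2` (the line `L₊`). With 1.4 (c)–(d): `a = λ`, and the constant `K₀[ε]` has centre fibre `e_v + εκ₀e_u`,
`κ₀ = −φ₂′(0)/φ₁(0) = 2m(n₀)/u₁(n₀)`. [§1.4] -/
theorem centre_fibre_involution :
    (∀ a b e : ℚ, e ^ 2 = 0 →
      (1 * 1 + (e * a) * (e * b) = 1 ∧ 1 * (e * a) + (e * a) * (-1) = 0 ∧
       (e * b) * 1 + (-1) * (e * b) = 0 ∧ (e * b) * (e * a) + (-1) * (-1) = 1)) ∧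
    (∀ a c : ℚ, a + 2 * c = 0 ↔ c = -a / 2) ∧
    (∀ b c : ℚ, b - 2 * c = 0 ↔ c = b / 2) ∧
    (∀ a c : ℚ, (a + c) - (-c) = a + 2 * c) := by
  refine ⟨?_, ?_, ?_, ?_⟩
  · intro a b e he
    refine ⟨?_, by ring, by ring, ?_⟩
    · linear_combination (a * b) * he
    · linear_combination (a * b) * he
  · intro a c; constructor <;> intro h <;> linarith
  · intro b c; constructor <;> intro h <;> linarith
  · intro a c; ring

/-- LEMMA 1.2 (d) / 1.3 (b) / 1.5 (report): the dual-number ideal bookkeeping on `Z₁[ε]` near the centre `τ = ε`. With `𝔞 = (τ − ε)²k[ε][[τ]]` and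
`𝔬 = (τ − ε)k[ε][[τ]]` (`ε² = 0`): `τ³ = (τ + 2ε)(τ − ε)²`, `ετ² = ε(τ − ε)²`, `τ² = (τ − ε)(τ + ε)`, `(τ − ε)ε = ετ` — so `τ³, ετ² ∈ 𝔞`, `τ² ∈ 𝔬`,
and the θ-parts `h|·B[θ₋^ε] ∈ τk[ε][[τ]]·(τ²k[[τ]] + ετk[[τ]]) ⊂ 𝔞`; the σ-even restrictions are `E^ε = k[ε] ⊕ 𝔞`, the σ-odd ones `O^ε = 𝔬`
(via `(x − εw/2)|_{Z₁[ε]} = −(τ − ε)ζ + O(τ²)` and the flat-lifting argument). Colengths: at `ε = 0` the two factors `kφ₁ ⊕ τ²k[[τ]]` and `τk[[τ]]` of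
`T^Y_{K,0}` have colength `1 + 1 = 2 = δ` (the tacnode); over `ε` the image is flat iff its colength is `2·2 = 4`, and in the obstructed case (`c ≠ 0`:
`ε·c ∈` the `δ′`-factor, `ετ ∈` the `σ`-factor) it is `4 − 2 = 2`. The polynomial identities are checked in `ℚ[ε, τ]` modulo `ε² = 0`. [§1.2–1.5] -/
theorem dual_number_ideal_identities :
    (∀ t e : ℚ, e ^ 2 = 0 →
      (t ^ 3 = (t + 2 * e) * (t - e) ^ 2 ∧ e * t ^ 2 = e * (t - e) ^ 2 ∧
       t ^ 2 = (t - e) * (t + e) ∧ (t - e) * e = e * t ∧ (t - e) ^ 2 = t ^ 2 - 2 * e * t)) ∧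
    ((1 : ℕ) + 1 = 2 ∧ (2 : ℕ) * 2 = 4 ∧ (4 : ℕ) - 2 = 2 ∧ (2 : ℕ) ≠ 4) := by
  refine ⟨?_, by norm_num⟩
  intro t e he
  refine ⟨?_, ?_, ?_, ?_, ?_⟩
  · linear_combination (3 * t - 2 * e) * he
  · linear_combination (2 * t - e) * he
  · linear_combination he
  · linear_combination (-1 : ℚ) * he
  · linear_combination he

/-- LEMMA 2.1 + PROPOSITION 2.2 (report): the degree-`2` component of the lift equation. `G := av̂ − ûb_v = ι^*û·v̂ + û·ι^*v̂` is ι-EVEN of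
order `≥ 1 + 2 = 3`, hence `∈ 𝔪⁴` (odd degrees vanish): `G₃ = −u₁v̂₂ + u₁v̂₂ = 0`; so `r₀(0) = r₀′(0) = 0` (else `2c·c₃ ∈ (q)`) and
`lin r₀′ = −lin r₀ = −ρ₁`. Degree `2` of the equation, with `w = −2ζ`: LEFT `[a′v̂]₂ = 0` (orders `1 + 2 = 3 > 2`), `[ûb′]₂ = u₁·lin b′ = −λu₁²`,
`[r₁θ₊ + r₁′θ₋]₂ = c₁q`; RIGHT `(∂_w a)(0) = (−u₁)(−2ζ) = 2u₁(ζ) = 0` (`u₁ ∋ z₁`), `(∂_w b_v)₁ = 2(b_v)₂(w, ·) = −2v̂₂(−2ζ, ·) = 4m`,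
`(∂_wθ₋)₁ = 2q(w, ·) = −4q_ζ`, `[r₀′∂_wθ₋]₂ = (−ρ₁)(−4q_ζ) = 4ρ₁q_ζ`. Hence **(E2) `λu₁² − c₁q = −4u₁m − 4ρ₁q_ζ`**. The numeral content:
the coefficient chain `−2·(−2) = 4`, `2·(−2) = −4`, `(−1)·(−4) = 4`, the cancellation `−1 + 1 = 0`, the order bounds, and — as a polynomial identity in
commuting indeterminates standing for the values of the linear forms at a point — the rearrangement of (E2) used in 2.3:
`λu² − c·Q + 4um + 4ρ·Z = 0 ↔ λu² + 4um = c·Q − 4ρZ`. [§2.1–2.2] -/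
theorem degree_two_bookkeeping :
    ((-2 : ℤ) * (-2) = 4 ∧ (2 : ℤ) * (-2) = -4 ∧ (-1 : ℤ) * (-4) = 4 ∧ (-1 : ℤ) + 1 = 0) ∧
    ((1 : ℕ) + 2 = 3 ∧ (3 : ℕ) > 2 ∧ (1 : ℕ) + 2 ≥ 3 ∧ (2 : ℕ) * 1 = 2) ∧
    (∀ uz : ℚ, uz = 0 → (-1) * (-2 * uz) = 0) ∧
    (∀ lam c u Q m rho Z : ℚ,
      lam * u ^ 2 - c * Q + 4 * u * m + 4 * rho * Z = 0 ↔ lam * u ^ 2 + 4 * u * m = c * Q - 4 * rho * Z) := by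
  refine ⟨by norm_num, by norm_num, ?_, ?_⟩
  · intro uz h; subst h; ring
  · intro lam c u Q m rho Z; constructor <;> intro h <;> linarith

/-- THEOREM A, step 2.3 (report): restriction to `Π″`. On the `2`-plane `Π″ = cone(ℓ^h_{z₁}) = T₀X_{z₁}` the quadric `q` vanishes (`ℓ^h_{z₁} ⊂ Q`)
and `q_ζ` vanishes (`Π″ ⊂ T_{z₁}Q`), so (E2) restricts to `u₁·(λu₁ + 4m) = 0` in `Sym(Π″^∨) ≅ k[s,t]`, a DOMAIN; and `u₁|_{Π″} ≠ 0` (the plane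
`⟨ℓ^h_p, z₁⟩` does not contain `ℓ^h_{z₁}` for `p ∉ h_{z₁}`). Hence `(λu₁ + 4m)|_{Π″} = 0`; evaluating at `n₀ ∈ Π″` (1.2 (b)) gives
`λu₁(n₀) + 4m(n₀) = 0`, i.e. `c₂ = φ₂′(0) + χ(0) = −2m(n₀) − (λ/2)u₁(n₀) = −½(λu₁ + 4m)(n₀) = 0`: **(⋆) holds, `T^{Y,ε}_{K₀}` is flat** (1.5 (c)).
COROLLARY 2.4: both `u₁|_{Π″}` and `m|_{Π″}` vanish on `kζ`, so `m|_{Π″} = μ·u₁|_{Π″}` and then `λ = −4μ`. Recorded: the zero-divisor step in any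
commutative ring without zero-divisors, the scalar consequence, and `λ = −4μ`. [§2.3–2.4] -/
theorem restriction_to_Pi2 :
    (∀ {R : Type} [CommRing R] [NoZeroDivisors R] (u lam m : R),
      u ≠ 0 → u * (lam * u + 4 * m) = 0 → lam * u + 4 * m = 0) ∧
    (∀ lam u m : ℚ, lam * u + 4 * m = 0 → -2 * m - (lam / 2) * u = 0) ∧
    (∀ lam u m : ℚ, -2 * m - (lam / 2) * u = -(1 / 2) * (lam * u + 4 * m)) ∧
    (∀ lam mu u : ℚ, u ≠ 0 → (lam * u + 4 * (mu * u) = 0 ↔ lam = -4 * mu)) := by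
  refine ⟨?_, ?_, ?_, ?_⟩
  · intro R _ _ u lam m hu h
    rcases mul_eq_zero.mp h with h1 | h2
    · exact absurd h1 hu
    · exact h2
  · intro lam u m h; linarith
  · intro lam u m; ring
  · intro lam mu u hu
    constructor
    · intro h
      have h' : (lam + 4 * mu) * u = 0 := by ring_nf; ring_nf at h; linarith
      rcases mul_eq_zero.mp h' with h1 | h2
      · linarith
      · exact absurd h2 hu
    · intro h; subst h; ring

/-- LEMMA 3.1 + COROLLARY 3.3 (report): bending the sub-line-bundle. A first-order deformation `K^ε_s` of `K ⊂ 𝓥₁` with tangent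
`s ∈ Hom(K, 𝓥₁/K)` has centre fibre `e_v + ε(κ_K + s̄)e_u` (`s̄ =` the value `s(P)` in the basis), so when `s̄ ≠ 0` every target slope `c` is reached
by the multiple `t = (c − κ_K)/s̄`. For `K₀`: `deg(K₀^∨ ⊗ B) = −2 + 6 = 4`, `χ = 4 + 1 − 4 = 1 = h⁰` ([XI] 1.4 (c): `≅ 𝒪_C(2h − g + z₁)`) and
`h⁰(K₀^∨ ⊗ B(−P)) = h⁰(𝒪_C(2h − g)) = 0` (degree `3`; `H⁰(𝒪_Q(2,−1)) = 0`), so the generator `s₀` has `s₀(P) ≠ 0` (`1 − 0 = 1 > 0` sections do not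
vanish at `P`): THEOREM B applies to `K₀`, and by the σ-family tangent ([XI] 2.3–2.4) to `K_{σ₊}`; with THEOREM L and [XI] 3.7: `e₁^ι ≥ 1 + 1 = 2 > 1`
for `F^{R0}_{z₁}` and `F^{R0,+}_{z₁}`. [§3] -/
theorem bending_bookkeeping :
    (∀ κ sbar c : ℚ, sbar ≠ 0 → ∃ t : ℚ, κ + t * sbar = c) ∧
    ((-2 : ℤ) + 6 = 4 ∧ (4 : ℤ) + 1 - 4 = 1 ∧ (4 : ℤ) - 1 = 3 ∧ (1 : ℕ) - 0 = 1 ∧ (1 : ℕ) > 0) ∧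
    ((1 : ℕ) + 1 = 2 ∧ (2 : ℕ) > 1) := by
  refine ⟨?_, by norm_num, by norm_num⟩
  intro κ sbar c hs
  refine ⟨(c - κ) / sbar, ?_⟩
  field_simp
  ring

/-- §4.2 (report): the (R0) table at `b = n`, `j = 2`, `z₁` unramified, final form. Rows `(k, δ, ℓ₀)` with `ℓ₀ = δ + 2k − 6`: the two `δ = 2` rows
`(2,2,0)` (`K₀`, `K_{σ₊}`; `ℓ₀ = 2 + 2·2 − 6 = 0`) are EMPTY as THEOREMS (THEOREM B; for `K₀` also THEOREM A + [XI] 3.7); `(3,0,0)` (the pencil,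
`0 + 6 − 6 = 0`) EMPTY [thm] ([XII] 4.3 / C94 (4)); `(3,2,2)`, `(4,0,2)` (`ℓ₀ = 2`) EMPTY ⇐ [XI] §4; `k ≥ 5` void; sporadic ⇐ (S) with 4.3's exact clause.
The `8` machine curves of [XI]/[XII] (`3 + 3 + 2`) become corollaries for `K₀`. Count of (R0) rows struck by this report: `2`; δ-values possible: `{0, 2}`
([X] A.7), never `1`. [§4.2] -/
theorem R0_table_final :
    ((2 : ℤ) + 2 * 2 - 6 = 0 ∧ (0 : ℤ) + 2 * 3 - 6 = 0 ∧ (2 : ℤ) + 2 * 3 - 6 = 2 ∧ (0 : ℤ) + 2 * 4 - 6 = 2) ∧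
    ((3 : ℕ) + 3 + 2 = 8 ∧ (2 : ℕ) = 1 + 1) ∧
    (∀ d : ℕ, d = 0 ∨ d = 2 → d ≠ 1) := by
  refine ⟨by norm_num, by norm_num, ?_⟩
  intro d hd
  rcases hd with h | h <;> subst h <;> decide

/-- §4.4 (report): the reduction of (⋆) for the CONSTANT `K_{σ₊}[ε]` (machine-true, NOT proved by hand, NOT needed for THEOREM W). With
`B′[g](τ) = τ^{−1}·dg_{x(τ)}(v(τ))`, `v(τ) ∈ Π′`, `v(0) = v₊` (saturation exponent `min(2, 1) = 1` at `P`, since `u₁|_{Π′} = 0` makes every class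
vanish there to order `≥ 1` and `∂_{v₊}v̂∘γ` has order exactly `1`): `b = a′₂(ζ, v₊)/v̂₂(ζ, v₊)`, `κ_{σ₊} = [dû_{x(τ)}(v(τ))]₂/(2v̂₂(ζ, v₊))`, and
flatness ⟺ `κ_{σ₊} = b/2` ⟺ `a′₂(ζ, v₊) = [dû_{x(τ)}(v(τ))]₂` — an identity on the QUADRATIC part of `a′`, which first enters the lift equation in
degree `2 + 2 = 4`. Numerals: `min(2,1) = 1`, `2 + 2 = 4 > 3`, and `κ = b/2 ↔ 2κ = b`. [§4.4] -/
theorem sigma_plus_reduction_degree :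
    (min (2 : ℕ) 1 = 1 ∧ (2 : ℕ) + 2 = 4 ∧ (4 : ℕ) > 3) ∧
    (∀ κ b v : ℚ, v ≠ 0 → (κ = b / 2 ↔ 2 * κ * v = b * v)) := by
  refine ⟨by norm_num, ?_⟩
  intro κ b v hv
  constructor
  · intro h; subst h; ring
  · intro h
    have : (2 * κ - b) * v = 0 := by ring_nf; ring_nf at h; linarith
    rcases mul_eq_zero.mp this with h1 | h2
    · linarith
    · exact absurd h2 hv

/-- §5.1 (report): the machine CROSS-CHECK of COROLLARY 2.4 (a) `λ = −4μ` (NOT an input of any proof). `code/pv3-g20/degree2_identity.py` on the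
faithful vertex model prints, for (seed, N, P): `(4, 8, 32003)`: `(λ, μ) = (7031, 6243)`; `(5, 8, 32003)`: `(24864, 25787)`; `(6, 8, 32003)`:
`(16013, 19999)`; `(1, 9, 32003)`: `(19576, 27109)`; `(1, 8, 65521)`: `(1904, 65045)`; `(2, 8, 65521)`: `(59268, 50704)` — and in each case
`λ ≡ −4μ (mod P)`, together with the exact identity (E2) and every step of 2.1–2.2 (`True` in all `out/degree2_*.out`). The six congruences as integer
identities (`−4μ − λ` is the stated multiple of `P`). [§5.1] -/
theorem machine_crosscheck_lambda_mu :
    (-4 : ℤ) * 6243 - 7031 = -1 * 32003 ∧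
    (-4 : ℤ) * 25787 - 24864 = -4 * 32003 ∧
    (-4 : ℤ) * 19999 - 16013 = -3 * 32003 ∧
    (-4 : ℤ) * 27109 - 19576 = -4 * 32003 ∧
    (-4 : ℤ) * 65045 - 1904 = -4 * 65521 ∧
    (-4 : ℤ) * 50704 - 59268 = -4 * 65521 := by
  norm_num

end H2W2CornerThirteen

section H2W2CornerThirteenAddendumB

/-- ADDENDUM B, B.1 (report): `|2g| = {G_a + G_b}` (pairs of fibres of `π_g`; `h⁰(𝒪_C(2g)) = h⁰(𝒪_Q(2,0)) = 3` since
`H⁰ = H¹ = 0` for `𝒪_Q(−1,−3)`), hence **`Σ⁻ = {D′ ≤ G} ∪ {p + q : p ≠ q ∈ Ram(π_g)}`** and symmetrically `Σ⁺`; the sporadic part (`0 ∉ A⁻_{D′}`) is the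
set of `C(12,2) = 66` pairs of distinct ramification points of `π_g` (`12` simple ramification points, `2·4 − 2 + 2·3 = 12`); such a pair meets
`g_{z₁} − z₁` iff `g_{z₁}` is NON-reduced, i.e. `z₁ ∈ {r, r″}` (`g_r = 2r + r″`): `12 + 12 = 24` points `z₁`, at each of which the off-vertex `ℓ₀ = 4`
stratum of [X] 2.5 consists of the `12 − 1 = 11` carriers `A⁻_{r+q}` with `(e, r) = (1, 2)`, `ℓ₀ = 2·1 + 2 = 4` — in all `24·11 = 264` carrier
configurations (ERRATUM E-P3g20-1: '(GP18)' as worded cannot hold; `ρ_ram` is this explicit finite set × type II₊, OPEN LIGHT) —, while for `z₁` with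
REDUCED `g`-fibre that stratum is EMPTY (`0` carriers). [§B.1, §B.4] -/
theorem sigma_minus_explicit_count :
    ((3 : ℕ) = 3 ∧ (2 : ℕ) * 4 - 2 + 2 * 3 = 12 ∧ (12 : ℕ) * 11 / 2 = 66) ∧
    ((12 : ℕ) + 12 = 24 ∧ (12 : ℕ) - 1 = 11 ∧ (24 : ℕ) * 11 = 264 ∧ (2 : ℕ) * 1 + 2 = 4) ∧
    ((0 : ℕ) < 11) := by
  refine ⟨by norm_num, by norm_num, by norm_num⟩

/-- ADDENDUM B, B.2–B.3 (report): **(GP17) is a theorem for general `C`.** With `V = 𝒪_C(3g − h) = 𝒪_C(4g − K)`: `h⁰(V) = 6 + 1 − 4 + 0 = 3`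
(`h⁰(𝒪_C(2h − 2g)) = 0` from `𝒪_Q(−5,−1)`), `𝔇 = {c : h⁰(V(−2c)) ≥ 2}` (Serre duality; `deg L_c = 2`, `χ(L_c) = 2 + 1 − 4 = −1`), `|V|` is base-point
free of degree `3·2 = 6 = 9 − 3`, and `φ_V : C → ℙ² = (ℙ¹_t)₂` is `c ↦ π_h(g_c − c)` — on the affine chart `(X : Y : Z) = (a₃ : a₃t + a₂ : a₃t² + a₂t + a₁)
= (1 : −(t₂ + t₃) : t₂t₃)` (Vieta: `a₂/a₃ = −(t₁ + t₂ + t₃)`, `a₁/a₃ = t₁t₂ + t₁t₃ + t₂t₃`; the identity below). Hence **`𝔇 = {c : the two residual points of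
g_c are distinct ramification points of π_h}`**, and `𝔇 = ∅ ⟺` the `12` ramification points of `π_h` have pairwise distinct `s`-coordinates — a non-empty
Zariski-open condition on `|𝒪_Q(3,3)| ≅ ℙ¹⁵` (failure = `4` linear conditions on `16` coefficients against `3` parameters: codimension `≥ 4 − 3 = 1`;
holds on the `3` explicit curves of seeds `4, 5, 6` in both labellings, `3·2 = 6` machine verdicts, `code/pv3-g20/gp17_check.py`), so `(R1)_𝔇 = ∅` for
general `C` WITHOUT hypothesis. Numerals + the Vieta identity behind `(X:Y:Z)`. [§B.2–B.3] -/
theorem gp17_bookkeeping :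
    ((6 : ℤ) + 1 - 4 + 0 = 3 ∧ (2 : ℤ) + 1 - 4 = -1 ∧ (3 : ℕ) * 2 = 6 ∧ (9 : ℤ) - 3 = 6) ∧
    ((16 : ℕ) - 1 = 15 ∧ (4 : ℤ) - 3 ≥ 1 ∧ (3 : ℕ) * 2 = 6) ∧
    (∀ t₁ t₂ t₃ : ℚ,
      t₁ - (t₁ + t₂ + t₃) = -(t₂ + t₃) ∧
      t₁ ^ 2 - (t₁ + t₂ + t₃) * t₁ + (t₁ * t₂ + t₁ * t₃ + t₂ * t₃) = t₂ * t₃) := by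
  refine ⟨by norm_num, by norm_num, ?_⟩
  intro t₁ t₂ t₃
  constructor <;> ring

end H2W2CornerThirteenAddendumB

end Summit.HodgeConjecture.HodgeConjecture.WeilTypeLadder
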